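import Literature.NumberTheory.GaloisRepresentations.FrameRingPoints
import Literature.NumberTheory.GaloisRepresentations.CompleteLocalFiniteLevels
import Mathlib.FieldTheory.IntermediateField.Adjoin.Basic
import HarnessLib

/-!
# Evaluation points of `𝒪_L⟦X_{ij}⟧` and their uniqueness

Let `L/ℚ_p` be finite inside `ℚ̄_p`, `𝒪 = 𝒪_L`, `R⁰ = 𝒪⟦X_{ij}⟧ = frameRing L n`.  We PROVE:

* `frameEval` — **universal property**: for every complete local `𝒪`-algebra `T` with
  `λ ∈ 𝔪_T` and elements `t_{ij} ∈ 𝔪_T`, the `𝒪`-algebra homomorphism `R⁰ → T`, `X_{ij} ↦ t_{ij}`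
  (`X ↦ t` maps `𝔪₀ = (λ, X)` into `𝔪_T`, so the evaluation `S → T` extends to the completion
  by `IsAdicComplete.liftRingHom`); it is continuous (`frameEval_mem_pow`);
* `exists_framePoint_eq` — **evaluation**: for every family `t_{ij} ∈ ℚ̄_p` with `‖t_{ij}‖ < 1`
  there is an `𝒪`-algebra homomorphism `x : R⁰ → ℚ̄_p` with `x(X_{ij}) = t_{ij}` (the `t_{ij}`
  together with `L` generate a finite extension `E ⊆ ℚ̄_p`; `X ↦ t` maps `𝔪₀ = (λ, X)` into the
  maximal ideal of the complete ring `𝒪_E` (`PadicIntermediateFieldIntegers`), so the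
  evaluation `S → 𝒪_E` extends to the completion `R⁰` by the universal property
  `IsAdicComplete.liftRingHom`);
* `framePoint_ext` — **uniqueness**: two points with the same values on the `X_{ij}` agree
  (they agree on polynomials, which are dense, and points are continuous:
  `exists_norm_framePoint_pow_le`).

No named facts, no `sorry`.

## References

* [BLGGT] T. Barnet-Lamb, T. Gee, D. Geraghty, R. Taylor, Ann. of Math. 179 (2014), §1.2.
  [BarnetlambEtAl2014]
-/

noncomputable section

open IsLocalRing

namespace Literature.NumberTheory.GaloisRepresentations

variable {p : ℕ} [Fact p.Prime] (L : IntermediateField ℚ_[p] (PadicAlgCl p)) [FiniteDimensional ℚ_[p] L] (n : ℕ)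

/-! ### Uniqueness of points with given values on the variables -/

section Ext

variable [Algebra (intermediateFieldIntegers p L) (PadicAlgCl p)]
  [IsScalarTower (intermediateFieldIntegers p L) L (PadicAlgCl p)]

/-- The structure map `S → R⁰` as an `𝒪_L`-algebra homomorphism. [folklore] -/
def framePolyToRing : framePoly L n →ₐ[intermediateFieldIntegers p L] frameRing L n :=
  IsScalarTower.toAlgHom (intermediateFieldIntegers p L) (framePoly L n) (frameRing L n)

omit [FiniteDimensional ℚ_[p] L] [Algebra (intermediateFieldIntegers p L) (PadicAlgCl p)]
  [IsScalarTower (intermediateFieldIntegers p L) L (PadicAlgCl p)] in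
/-- Unfolding lemma for `framePolyToRing`. [folklore] -/
@[simp] theorem framePolyToRing_apply (s : framePoly L n) :
    framePolyToRing L n s = algebraMap (framePoly L n) (frameRing L n) s := rfl

/-- **A point of `𝒪_L⟦X⟧` is continuous**: `‖x r - x s‖ ≤ cᴺ` when `r ≡ s (mod 𝔪ᴺ)`. [folklore] -/
theorem norm_framePoint_sub_le (x : frameRing L n →ₐ[intermediateFieldIntegers p L] PadicAlgCl p) :
    ∃ c : ℝ, 0 ≤ c ∧ c < 1 ∧ ∀ (N : ℕ) (r s : frameRing L n),
      r - s ∈ maximalIdeal (frameRing L n) ^ N → ‖x r - x s‖ ≤ c ^ N := by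
  obtain ⟨c, hc0, hc1, hc⟩ := exists_norm_framePoint_pow_le L n x
  exact ⟨c, hc0, hc1, fun N r s h => by rw [← map_sub]; exact hc N _ h⟩

/-- **Uniqueness of points**: two `ℚ̄_p`-points of `𝒪_L⟦X_{ij}⟧` with the same values on the frame
variables are equal. [cite: BarnetlambEtAl2014, §1.2] -/
theorem framePoint_ext {x₁ x₂ : frameRing L n →ₐ[intermediateFieldIntegers p L] PadicAlgCl p}
    (h : ∀ ij, x₁ (frameVar L n ij) = x₂ (frameVar L n ij)) : x₁ = x₂ := by
  -- agreement on polynomials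
  have hpoly : ∀ s : framePoly L n, x₁ (algebraMap (framePoly L n) (frameRing L n) s) =
      x₂ (algebraMap (framePoly L n) (frameRing L n) s) := by
    have heq : x₁.comp (framePolyToRing L n) = x₂.comp (framePolyToRing L n) :=
      MvPolynomial.algHom_ext fun ij => by
        simp only [AlgHom.comp_apply, framePolyToRing_apply]
        exact h ij
    intro s
    have := congrArg (fun f => f s) heq
    simpa only [AlgHom.comp_apply, framePolyToRing_apply] using this
  -- density and continuity
  obtain ⟨c₁, hc₁0, hc₁1, hc₁⟩ := norm_framePoint_sub_le L n x₁
  obtain ⟨c₂, hc₂0, hc₂1, hc₂⟩ := norm_framePoint_sub_le L n x₂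
  refine AlgHom.ext fun r => ?_
  refine eq_of_forall_dist_le fun ε hε => ?_
  obtain ⟨N₁, hN₁⟩ := exists_pow_lt_of_lt_one hε hc₁1
  obtain ⟨N₂, hN₂⟩ := exists_pow_lt_of_lt_one hε hc₂1
  obtain ⟨s, hs⟩ := exists_polynomial_sub_mem_pow L n (max N₁ N₂) r
  have hs₁ : r - algebraMap (framePoly L n) (frameRing L n) s ∈ maximalIdeal (frameRing L n) ^ N₁ :=
    Ideal.pow_le_pow_right (le_max_left _ _) hs
  have hs₂ : r - algebraMap (framePoly L n) (frameRing L n) s ∈ maximalIdeal (frameRing L n) ^ N₂ :=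
    Ideal.pow_le_pow_right (le_max_right _ _) hs
  have h1 := hc₁ N₁ _ _ hs₁
  have h2 := hc₂ N₂ _ _ hs₂
  rw [hpoly s] at h1
  calc dist (x₁ r) (x₂ r) = ‖(x₁ r - x₂ (algebraMap (framePoly L n) (frameRing L n) s)) -
        (x₂ r - x₂ (algebraMap (framePoly L n) (frameRing L n) s))‖ := by
          rw [dist_eq_norm]; congr 1; abel
    _ ≤ max ‖x₁ r - x₂ (algebraMap (framePoly L n) (frameRing L n) s)‖
        ‖x₂ r - x₂ (algebraMap (framePoly L n) (frameRing L n) s)‖ := by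
          simpa only [sub_eq_add_neg, norm_neg] using
            IsUltrametricDist.norm_add_le_max (x₁ r - x₂ (algebraMap (framePoly L n) (frameRing L n) s))
              (-(x₂ r - x₂ (algebraMap (framePoly L n) (frameRing L n) s)))
    _ ≤ ε := max_le (h1.trans hN₁.le) (h2.trans hN₂.le)

end Ext

/-! ### The universal property of `𝒪_L⟦X_{ij}⟧` among complete local `𝒪_L`-algebras -/

section UniversalProperty

variable {T : Type*} [CommRing T] [IsLocalRing T] [Algebra (intermediateFieldIntegers p L) T]
  (hT : algebraMap (intermediateFieldIntegers p L) T (intermediateFieldIntegers.uniformizer L) ∈ maximalIdeal T)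
  (t : Fin n × Fin n → T) (ht : ∀ ij, t ij ∈ maximalIdeal T)

/-- The evaluation `S = 𝒪_L[X_{ij}] → T`, `X_{ij} ↦ t_{ij}`, as a ring homomorphism. [folklore] -/
def frameEvalPoly : framePoly L n →+* T :=
  (MvPolynomial.aeval t : framePoly L n →ₐ[intermediateFieldIntegers p L] T).toRingHom

omit [FiniteDimensional ℚ_[p] L] [IsLocalRing T] in
/-- `frameEvalPoly` is `MvPolynomial.aeval`. [folklore] -/
@[simp] theorem frameEvalPoly_apply (s : framePoly L n) : frameEvalPoly L n t s = MvPolynomial.aeval t s := rfl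

include hT ht in
/-- `X ↦ t` maps `𝔪₀ = (λ, X)` into the maximal ideal of `T`. [folklore] -/
theorem frameIdeal_le_comap_frameEvalPoly : frameIdeal L n ≤ (maximalIdeal T).comap (frameEvalPoly L n t) := by
  rw [frameIdeal_eq_span, Ideal.span_le]
  rintro f (rfl | ⟨ij, rfl⟩)
  · rw [SetLike.mem_coe, Ideal.mem_comap, frameEvalPoly_apply, MvPolynomial.aeval_C]
    exact hT
  · rw [SetLike.mem_coe, Ideal.mem_comap, frameEvalPoly_apply, MvPolynomial.aeval_X]
    exact ht ij

/-- The induced maps on levels `R⁰ → S/𝔪₀ᴺ → T/𝔪_Tᴺ`. [folklore] -/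
def frameEvalLevel (N : ℕ) : frameRing L n →+* T ⧸ maximalIdeal T ^ N :=
  (Ideal.quotientMap (maximalIdeal T ^ N) (frameEvalPoly L n t)
    ((Ideal.pow_right_mono (frameIdeal_le_comap_frameEvalPoly L n hT t ht) N).trans (Ideal.le_comap_pow _ N))).comp
    (AdicCompletion.evalₐ (frameIdeal L n) N).toRingHom

/-- Unfolding of `frameEvalLevel`. [folklore] -/
theorem frameEvalLevel_apply (N : ℕ) (x : frameRing L n) :
    frameEvalLevel L n hT t ht N x = Ideal.quotientMap (maximalIdeal T ^ N) (frameEvalPoly L n t)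
      ((Ideal.pow_right_mono (frameIdeal_le_comap_frameEvalPoly L n hT t ht) N).trans (Ideal.le_comap_pow _ N))
      (AdicCompletion.evalₐ (frameIdeal L n) N x) :=
  rfl

/-- `frameEvalLevel` on polynomials. [folklore] -/
theorem frameEvalLevel_algebraMap (N : ℕ) (s : framePoly L n) :
    frameEvalLevel L n hT t ht N (algebraMap (framePoly L n) (frameRing L n) s) =
      Ideal.Quotient.mk _ (MvPolynomial.aeval t s) := by
  rw [frameEvalLevel_apply, AdicCompletion.algebraMap_apply, Algebra.algebraMap_self, RingHom.id_apply,
    AdicCompletion.evalₐ_of, Ideal.quotientMap_mk, frameEvalPoly_apply]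

omit [FiniteDimensional ℚ_[p] L] in
/-- Transition compatibility of `evalₐ`. [folklore] -/
theorem factorPow_evalₐ {m k : ℕ} (hmk : m ≤ k) (x : frameRing L n) :
    Ideal.Quotient.factorPow (frameIdeal L n) hmk (AdicCompletion.evalₐ (frameIdeal L n) k x) =
      AdicCompletion.evalₐ (frameIdeal L n) m x := by
  obtain ⟨y, rfl⟩ := AdicCompletion.mk_surjective (frameIdeal L n) (framePoly L n) x
  rw [AdicCompletion.evalₐ_mk, AdicCompletion.evalₐ_mk, Ideal.Quotient.factor_mk]
  exact AdicCompletion.Ideal.mk_eq_mk _ hmk y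

/-- The level maps are compatible. [folklore] -/
theorem frameEvalLevel_compat {m k : ℕ} (hmk : m ≤ k) :
    (Ideal.Quotient.factorPow (maximalIdeal T) hmk).comp (frameEvalLevel L n hT t ht k) = frameEvalLevel L n hT t ht m := by
  refine RingHom.ext fun x => ?_
  obtain ⟨z, hz⟩ := Ideal.Quotient.mk_surjective (AdicCompletion.evalₐ (frameIdeal L n) k x)
  have hzm : AdicCompletion.evalₐ (frameIdeal L n) m x = Ideal.Quotient.mk _ z := by
    rw [← factorPow_evalₐ L n hmk, ← hz, Ideal.Quotient.factor_mk]
  rw [RingHom.comp_apply, frameEvalLevel_apply, frameEvalLevel_apply, ← hz, hzm, Ideal.quotientMap_mk,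
    Ideal.quotientMap_mk, Ideal.Quotient.factor_mk]

variable [IsAdicComplete (maximalIdeal T) T]

/-- The evaluation `𝒪_L⟦X⟧ → T` extending `X ↦ t`, as a ring homomorphism (universal property of
the complete ring `T`). [folklore] -/
def frameEvalRingHom : frameRing L n →+* T :=
  IsAdicComplete.liftRingHom (maximalIdeal T) (frameEvalLevel L n hT t ht) (frameEvalLevel_compat L n hT t ht)

/-- `frameEvalRingHom` on polynomials is `MvPolynomial.aeval t`. [folklore] -/
theorem frameEvalRingHom_algebraMap (s : framePoly L n) :
    frameEvalRingHom L n hT t ht (algebraMap (framePoly L n) (frameRing L n) s) = MvPolynomial.aeval t s := by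
  refine CompleteLocalRing.eq_of_forall_mk_eq (maximalIdeal T) fun N => ?_
  rw [frameEvalRingHom, IsAdicComplete.mk_liftRingHom, frameEvalLevel_algebraMap]

/-- **The universal property of `𝒪_L⟦X_{ij}⟧`**: for a complete local `𝒪_L`-algebra `T` in which
the uniformizer of `𝒪_L` is not a unit and elements `t_{ij} ∈ 𝔪_T`, the `𝒪_L`-algebra
homomorphism `frameEval : 𝒪_L⟦X_{ij}⟧ → T` with `X_{ij} ↦ t_{ij}`. [folklore] -/
def frameEval : frameRing L n →ₐ[intermediateFieldIntegers p L] T where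
  toRingHom := frameEvalRingHom L n hT t ht
  commutes' a := by
    change frameEvalRingHom L n hT t ht (algebraMap (intermediateFieldIntegers p L) (frameRing L n) a) = _
    rw [IsScalarTower.algebraMap_apply (intermediateFieldIntegers p L) (framePoly L n) (frameRing L n),
      MvPolynomial.algebraMap_eq, frameEvalRingHom_algebraMap, MvPolynomial.aeval_C]

/-- `frameEval` on polynomials. [folklore] -/
theorem frameEval_algebraMap (s : framePoly L n) :
    frameEval L n hT t ht (algebraMap (framePoly L n) (frameRing L n) s) = MvPolynomial.aeval t s :=
  frameEvalRingHom_algebraMap L n hT t ht s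

/-- **`frameEval (X_{ij}) = t_{ij}`.** [folklore] -/
@[simp] theorem frameEval_frameVar (ij : Fin n × Fin n) : frameEval L n hT t ht (frameVar L n ij) = t ij := by
  change frameEval L n hT t ht (algebraMap (framePoly L n) (frameRing L n) (MvPolynomial.X ij)) = _
  rw [frameEval_algebraMap, MvPolynomial.aeval_X]

/-- The reductions of `frameEval`. [folklore] -/
theorem mk_frameEval (N : ℕ) (r : frameRing L n) :
    Ideal.Quotient.mk (maximalIdeal T ^ N) (frameEval L n hT t ht r) = frameEvalLevel L n hT t ht N r :=
  IsAdicComplete.mk_liftRingHom _ _ (frameEvalLevel_compat L n hT t ht) N r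

/-- **`frameEval` is continuous**: it maps `𝔪ᴺ` into `𝔪_Tᴺ`. [folklore] -/
theorem frameEval_mem_pow {N : ℕ} {r : frameRing L n} (hr : r ∈ maximalIdeal (frameRing L n) ^ N) :
    frameEval L n hT t ht r ∈ maximalIdeal T ^ N := by
  rw [← Ideal.Quotient.eq_zero_iff_mem, mk_frameEval, frameEvalLevel_apply, (evalₐ_eq_zero_iff L n N r).2 hr, map_zero]

end UniversalProperty

/-! ### Evaluation points -/

section Eval

variable {E : IntermediateField ℚ_[p] (PadicAlgCl p)} [FiniteDimensional ℚ_[p] E] (hLE : L ≤ E)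

/-- `𝒪_L → 𝒪_E` for `L ≤ E`. [folklore] -/
def integersInclusion : intermediateFieldIntegers p L →+* intermediateFieldIntegers p E where
  toFun a := ⟨IntermediateField.inclusion hLE (a : L), by
    rw [mem_intermediateFieldIntegers_iff]
    exact (mem_intermediateFieldIntegers_iff L (a : L)).1 a.2⟩
  map_one' := Subtype.ext (by simp)
  map_mul' a b := Subtype.ext (by simp)
  map_zero' := Subtype.ext (by simp)
  map_add' a b := Subtype.ext (by simp)

omit [FiniteDimensional ℚ_[p] L] [FiniteDimensional ℚ_[p] E] in
/-- `integersInclusion` is the identity on `ℚ̄_p`. [folklore] -/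
@[simp] theorem coe_coe_integersInclusion (a : intermediateFieldIntegers p L) :
    (((integersInclusion L hLE a : intermediateFieldIntegers p E) : E) : PadicAlgCl p) = ((a : L) : PadicAlgCl p) :=
  rfl

omit [FiniteDimensional ℚ_[p] E] in
/-- The uniformizer of `𝒪_L` lies in the maximal ideal of `𝒪_E`. [folklore] -/
theorem integersInclusion_uniformizer_mem :
    integersInclusion L hLE (intermediateFieldIntegers.uniformizer L) ∈ maximalIdeal (intermediateFieldIntegers p E) := by
  rw [intermediateFieldIntegers.mem_maximalIdeal_iff, intermediateFieldIntegers.norm_coe, coe_coe_integersInclusion,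
    ← intermediateFieldIntegers.norm_coe]
  exact intermediateFieldIntegers.norm_uniformizer_lt_one L

variable (t : Fin n × Fin n → PadicAlgCl p) (htE : ∀ ij, t ij ∈ E) (ht : ∀ ij, ‖t ij‖ < 1)

/-- The values `t_{ij}` as elements of `𝒪_E`. [folklore] -/
def evalValues (ij : Fin n × Fin n) : intermediateFieldIntegers p E :=
  ⟨⟨t ij, htE ij⟩, by rw [mem_intermediateFieldIntegers_iff]; exact (ht ij).le⟩

omit [FiniteDimensional ℚ_[p] E] in
/-- The underlying element of `evalValues`. [folklore] -/
@[simp] theorem coe_coe_evalValues (ij : Fin n × Fin n) :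
    (((evalValues n t htE ht ij : intermediateFieldIntegers p E) : E) : PadicAlgCl p) = t ij := rfl

omit [FiniteDimensional ℚ_[p] E] in
/-- The values lie in the maximal ideal of `𝒪_E`. [folklore] -/
theorem evalValues_mem (ij : Fin n × Fin n) : evalValues n t htE ht ij ∈ maximalIdeal (intermediateFieldIntegers p E) := by
  rw [intermediateFieldIntegers.mem_maximalIdeal_iff, intermediateFieldIntegers.norm_coe, coe_coe_evalValues]
  exact ht ij

variable [Algebra (intermediateFieldIntegers p L) (PadicAlgCl p)]
  [IsScalarTower (intermediateFieldIntegers p L) L (PadicAlgCl p)]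

/-- **The evaluation point `x_t : 𝒪_L⟦X⟧ → ℚ̄_p`** with `x_t(X_{ij}) = t_{ij}` (through `𝒪_E`, by the
universal property `frameEval`). [folklore] -/
def evalPoint : frameRing L n →ₐ[intermediateFieldIntegers p L] PadicAlgCl p :=
  letI : Algebra (intermediateFieldIntegers p L) (intermediateFieldIntegers p E) := (integersInclusion L hLE).toAlgebra
  { toRingHom := ((algebraMap E (PadicAlgCl p)).comp (algebraMap (intermediateFieldIntegers p E) E)).comp
      (frameEval L n (integersInclusion_uniformizer_mem L hLE) (evalValues n t htE ht) (evalValues_mem n t htE ht)).toRingHom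
    commutes' := fun a => by
      change algebraMap E (PadicAlgCl p) (algebraMap (intermediateFieldIntegers p E) E
        (frameEval L n (integersInclusion_uniformizer_mem L hLE) (evalValues n t htE ht) (evalValues_mem n t htE ht)
          (algebraMap (intermediateFieldIntegers p L) (frameRing L n) a))) = _
      rw [AlgHom.commutes, algebraMap_integers_padicAlgCl_apply]
      rfl }

/-- **Values of the evaluation point on the variables.** [folklore] -/
@[simp] theorem evalPoint_frameVar (ij : Fin n × Fin n) : evalPoint L n hLE t htE ht (frameVar L n ij) = t ij := by
  letI : Algebra (intermediateFieldIntegers p L) (intermediateFieldIntegers p E) := (integersInclusion L hLE).toAlgebra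
  change algebraMap E (PadicAlgCl p) (algebraMap (intermediateFieldIntegers p E) E
    (frameEval L n (integersInclusion_uniformizer_mem L hLE) (evalValues n t htE ht) (evalValues_mem n t htE ht)
      (frameVar L n ij))) = _
  rw [frameEval_frameVar]
  rfl

end Eval

section Exists

variable [Algebra (intermediateFieldIntegers p L) (PadicAlgCl p)]
  [IsScalarTower (intermediateFieldIntegers p L) L (PadicAlgCl p)]

/-- **Existence of points with prescribed small values on the variables**: for `t_{ij} ∈ ℚ̄_p` with
`‖t_{ij}‖ < 1` there is an `𝒪_L`-algebra homomorphism `x : 𝒪_L⟦X_{ij}⟧ → ℚ̄_p` with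
`x(X_{ij}) = t_{ij}` (work in the finite extension `E = L(t_{ij})` of `ℚ_p`).
[cite: BarnetlambEtAl2014, §1.2] -/
theorem exists_framePoint_eq (t : Fin n × Fin n → PadicAlgCl p) (ht : ∀ ij, ‖t ij‖ < 1) :
    ∃ x : frameRing L n →ₐ[intermediateFieldIntegers p L] PadicAlgCl p, ∀ ij, x (frameVar L n ij) = t ij := by
  classical
  let E : IntermediateField ℚ_[p] (PadicAlgCl p) := L ⊔ IntermediateField.adjoin ℚ_[p] (Set.range t)
  haveI : FiniteDimensional ℚ_[p] (IntermediateField.adjoin ℚ_[p] (Set.range t)) :=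
    IntermediateField.finiteDimensional_adjoin fun z _ => (Algebra.IsAlgebraic.isAlgebraic z).isIntegral
  haveI : FiniteDimensional ℚ_[p] E := IntermediateField.finiteDimensional_sup _ _
  have hLE : L ≤ E := le_sup_left
  have htE : ∀ ij, t ij ∈ E := fun ij =>
    (le_sup_right : IntermediateField.adjoin ℚ_[p] (Set.range t) ≤ E) (IntermediateField.subset_adjoin _ _ ⟨ij, rfl⟩)
  exact ⟨evalPoint L n hLE t htE ht, evalPoint_frameVar L n hLE t htE ht⟩

end Exists

end Literature.NumberTheory.GaloisRepresentations

end
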